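import Summits.BirchSwinnertonDyer.Rank1Residual.X11b.JetchevIndexRecordsKit
import HarnessLib

/-!
# BSD rank-≤1 residual cell, lane class X11b (`p ∥ N`: MULTIPLICATIVE at a prime `p ≥ 5`, `ρ̄_{E,p}` onto), rank ONE,
# Tamagawa-OBSTRUCTED with ONE Tamagawa prime: `BSD(E,p)` PER PAIR from Miller 2011 Thm. 5.4 (Cha case; FLAGGED) + GZK +
# a two-engine Jetchev HEEGNER-INDEX certificate in a DEEP field, the Tamagawa half and `E[p]` irreducible IN THE KERNEL — records 07

HONEST FRAMING (cell `b2b-bsdres-*`, verbatim): prove what is provable now; shrink each hard class to its core with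
data; no claim beyond stated classes; COMBINATION classes deleted from PUBLISHED theorems only, CONSTRUCTION-shaped
remainder typed; this is not "finishing BSD". X11b stays CONSTRUCTION-SHAPED; everything here is PER PAIR; no lane
verdict is changed; no named fact is introduced (debt 0: `hMJ`, `hGZK` are the tree's existing published named facts,
`hMJ` = Miller 2011 Thm. 5.4 in the Cha case carries the registry FLAGS `Miller11-Thm54-Cha-case` and `JET@p|N` —
these records are LITERAL currency, flag-free only the day director-bsd's ITEM (J∥) lands); nothing is booked by this
unit (census-lead, the Kurihara lane, the x11b lineage, bsd-jet and referee A decide what a record is worth); Cremona's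
numbers (`r_an = 1`, `#Ш_an`, models, generators, `∏ c_ℓ`, torsion, optimality / Manin codes, the galrep datum) and
the lane's per-prime `bad` tables are INPUTS.

Unit `b2b-bsdres-x11c`, GEN 33 (prover-b2b-bsdres-x11c-g33-0), move «JDEEP». POPULATION (`HOME/b2b-bsdres-x11c/gen33/jdeep/pop/`:
gen 32's class census `harvest_x11b_all.json` restricted to shape `tamobs` × this gen's zero-compute J-shape census of the
lane's own per-prime tables): of the 3 062 rank-ONE X11b cells at `p ≥ 5` that are OPEN on the Kurihara lane's residue of
record (bsdN sweep v4u/v5u) with `ρ̄_{E,p}` onto, `p ∤ #E(ℚ)_tors`, `p ∤ #Ш_an` but `p ∣ ∏ c_ℓ` (outside the Kolyvagin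
road of GEN 32's `KolyvaginIndexRecordsX11bRankOne01–95`), exactly **98 are «J1»: ONE prime `q ∣ N` with `p ∣ c_q`**
(always split multiplicative `Iₙ`, `w := ord_p c_q = ord_p n`; 82 @5, 15 @7, 1 @13; `q = p` itself for 27), 2 901 are J2
and 63 J3 (two / three such primes). For a J1 cell the Jetchev MAX-form bound `ord_p #Ш(E/ℚ) ≤ 2(ord_p [E(K):ℤy_K] −
max_q ord_p c_q)` reaches `0` in a Heegner field `K` with `ord_p [E(K):ℤy_K] = w` (Gross–Zagier + BSD over `K` predict
`ord_p [E(K):ℤy_K] = Σ_q ord_p c_q + ½ ord_p #Ш(E/K)`); the lane's fields of record (`|D| ≤ 1511`) read `w + 1` on every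
one of these 98 cells (the J1 cells with a `w`-field were booked T-JET literal and left the residue), so this gen ran the
cell's engine 1 DEEPER (VERBATIM, `NDISC 16` / `DBOUND 6000`) and found a `w`-field for the rows below; engine 2
(VERBATIM stdlib re-implementation) recomputes `m` EQUAL; the twist side (`E^D`: `#Ш_an`, `∏c`, torsion) is printed per
row (BSD-consistency: `ord_p #Ш_an(E^D) = 0`, `ord_p ∏c(E^D) = w`); the Tamagawa prime has THREE engines (A = Tate's
algorithm `tateY`, B = PARI `elllocalred`, C = the rank-2 observatory's certificate engine whose `TamLocal` certificate the
KERNEL re-checks). Kit jobs: engine 1 j268106 (14 c, 54 min), very deep j269293 (460020m1); engine 2 + twist values + Tamagawa engine B j269294 (8 c, 50 min); PARI third check j270395. Each record `bsdp_j<label>_<p>` is ONE application of the GEN 33 kit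
`X11b.bsdp_prime_of_jetchevIndex_of_tamLocal[_support]` (p496494; = the unit's gen-4 route
`bsdp_of_ainvs_of_jetchevChaCertificate` + kernel minimality + kernel irreducibility + n1011's kernel `c_q` transport) with
`decide` goals; binders displayed: `hMJ` (FLAGGED), `hGZK`, the Heegner datum (`K`, `p ∤ d_K`, `p² ∤ N`, `P = y_K` of
infinite order), `q ∣ N`, the index line `hv : ord_p [E(K):ℤP] ≤ w`, `r_an ≤ 1`, `#Ш_an` a `p`-adic unit. Currency:
LITERAL (the lane's T-JET row with flag `JET@p|N`; bucket-B-shaped for bsd-jet); every one of the 98 cells ALSO carries the unit's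
GEN 10 beyond-window DATA record (`X11b/BeyondWindowRecordsNN` ×95 / `BeyondWindowSurjRecordsNN` ×3, Skinner 2016 Thm. A /
Kato–Wuthrich road, binders as displayed there) — these records are a SECOND road for them. Table `HOME/b2b-bsdres-x11c/gen33/jdeep/JDEEP-TABLE.md`; population `jdeep/pop/JDEEP-POP.md`; J-shape census
`jdeep/pop/census_jpar.json`. Pairs in this file: `421680bo1`@5, `424830gh1`@5, `426360bm1`@5, `442890cf1`@5, `446880de1`@5, `451560j1`@5, `454155c1`@5, `457710k1`@5, `459690bo1`@5, `459690bq1`@5.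

References: R. L. Miller, LMS J. Comput. Math. 14 (2011) Thm. 5.4, Thm. 5.2, Thm. 4.1, Cor. 4.8, Def. 1.1 [Miller2011LMS];
D. Jetchev, Compos. Math. 144 (2008) Thm. 1.1 [Jetchev2008]; B. H. Gross, D. Zagier, Invent. Math. 84 (1986) I (6.5)
[GrossZagier1986]; B. Mazur, Invent. Math. 44 (1978) Prop. 6.3 (1) [Mazur1978]; J. Tate, LNM 476 (1975) §7 [Tate1975];
J. H. Silverman, GTM 151 (1994) IV.9.4 [Silverman1994]; J. H. Silverman, *AEC* (2009) VII.1 Rem. 1.1, VII.6 Ex. 7.6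
[SilvermanAEC2009]; A. Kraus, Acta Arith. 54 (1989) [Kraus1989]; J. E. Cremona, *Algorithms for Modular Elliptic Curves*
(1997) §3.2, Table 1 [CremonaAlgorithms1997]; Cremona's tables [Cremona2006].
-/

set_option autoImplicit false

noncomputable section

open scoped Classical

open WeierstrassCurve Literature.NumberTheory.EllipticCurves
  Literature.NumberTheory.EllipticCurves.Rank1Residual
  Literature.NumberTheory.EllipticCurves.Rank1Residual.Typed
  Literature.NumberTheory.EllipticCurves.Miller2011
  Literature.NumberTheory.EllipticCurves.Rank1Residual.X11RankOneCertificates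
  Summit.BirchSwinnertonDyer.BirchSwinnertonDyer.Rank1Residual.IntModel
  Summit.BirchSwinnertonDyer.BirchSwinnertonDyer.Rank1Residual.X11RankOne
  Summit.BirchSwinnertonDyer.BirchSwinnertonDyer.Rank2Observatory.Tam
  Summit.BirchSwinnertonDyer.Rank1Residual.Additive

namespace Summit.BirchSwinnertonDyer.Rank1Residual.X11b

/-- **`BSD(E,5)` for `421680bo1`** (`N = 421680 = 2⁴·3·5·7·251`; NON-SPLIT MULTIPLICATIVE at `5` (Kodaira `I7`, `c_5 = 1`); `#tors = 2`, `∏c = 40`,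
`r_an = 1`, `#Ш_an = 1`, `ρ̄_{E,5}` onto (Cremona galrep: 2B); lane residue cell `(5, X11b)` (bsdN v4u/v5u of record: `residue:X11b`);
ALSO the unit's GEN 10 beyond-window DATA record in `X11b/BeyondWindowRecords56.lean` (binders as displayed there)). Tamagawa-OBSTRUCTED, shape J1: the ONLY prime `q ∣ N` with `5 ∣ c_q` is `q = 3` (Kodaira `I5` split, `c_3 = 5`, `w = ord_5 c_3 = 1`) — engines A (Tate `tateY`) = B (PARI
`elllocalred`, j269294) = C (observatory `TamLocal` ⟨3, 1, 1, 2, 0, 0, 0, 5, 0, 0, 5⟩, re-checked by the kernel below). Lane fields of record (`|D| ≤ 1511`): `-479`: `m = 400` (`ord = 2`).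
DEEP FIELD `D = -1391` (13·107): **`m = [E(K):ℤy_K] = 320`, `ord_5 m = 1 = w`** (`ρ = 25600`; `L'(E,1) = 7.270909178`, `L(E^D,1) = 4.175331077`, `ĥ(x) = 8.11311722`; `N_{E^D} = 815900620080`)
— engine 1 (j268106) = engine 2 (j269294): `m = 320` EQUAL, dev. ≤ 4.7e-14, checks true; twist `E^D` (j269294): `N_F = 815900620080`, `#tors·∏c·#Ш_an = 2·640·16` — `ord_5 #Ш_an(E^D) = 0`, `ord_5 ∏c(E^D) = 1` — BSD-consistent. Jetchev MAX-form: `ord_5 #Ш(E/ℚ) ≤ 2(w − w) = 0 = ord_5 #Ш_an` ⇒ Miller's `BSD(E,5)` modulo the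
displayed binders (`hMJ` FLAGGED `Miller11-Thm54-Cha-case`, `JET@p|N`; `hGZK`; Heegner datum; `hv`; `hr`; `hs`). Kernel: `Δ ≠ 0`,
global minimality (support form, `bad = [(2, 4, 36), (3, 1, 5), (5, 1, 7), (7, 1, 1), (251, 1, 2)]`), `5 ∣ Δ ∧ 5 ∤ c₄`, `E[5]` irreducible (`ℓ = 13`, `#Ẽ(𝔽_13) = 16`, `a_13 = -2`, `X² − a_ℓX + ℓ` root-free
mod `5`), `c_3(W/ℚ_3) = 5` (`TamLocal` ⟨3, 1, 1, 2, 0, 0, 0, 5, 0, 0, 5⟩). Per pair; LITERAL currency; nothing booked.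
[cite: Miller2011LMS, Thm. 5.4 (arXiv:1010.2431 p. 11) and Def. 1.1] [cite: Jetchev2008, Thm. 1.1] [cite: Mazur1978, §6 Prop. 6.3 (1) (p. 153)]
[cite: Silverman1994, IV.9.4] [cite: Cremona2006, Table 1 (label 421680bo1)] -/
theorem bsdp_j421680bo1_5 (hMJ : thm54_cha_padicValNat_shaOrder_add_tamagawa_le)
    (hGZK : rank_eq_analyticRank_of_analyticRank_le_one) (W : WeierstrassCurve ℚ)
    (hW : W = ⟨0, 1, 0, -38813696, 85607520180⟩) {N : ℕ} [NeZero N] {K : Type} [Field K] [NumberField K]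
    (hK : IsImaginaryQuadratic K) (hH : SatisfiesHeegnerHypothesis N K) {P : (W.baseChange K).toAffine.Point}
    (hP : IsHeegnerPoint N W K P) (hnt : ¬ IsOfFinAddOrder P) (hpD : ¬ (5 : ℤ) ∣ NumberField.discr K)
    (hpN : ¬ 5 ^ 2 ∣ N) (hqN : 3 ∣ N) (hv : padicValNat 5 (AddSubgroup.zmultiples P).index ≤ 1)
    (hr : W.analyticRank ≤ 1) {s : ℚ} (hs : shaAn W = (s : ℂ)) (hvs : padicValRat 5 s = 0) : BSDp W 5 :=
  bsdp_prime_of_jetchevIndex_of_tamLocal_support 5 (by norm_num) (by norm_num) 0 1 0 (-38813696) 85607520180 (by decide +kernel)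
    [(2, 4, 36), (3, 1, 5), (5, 1, 7), (7, 1, 1), (251, 1, 2)] (by decide +kernel) (by decide +kernel) (by decide +kernel)
    (by decide +kernel) (by decide +kernel) 13 (by norm_num) (by norm_num) (by norm_num)
    (by decide +kernel) (n := 16) (by decide +kernel) (by decide +kernel) 3 (by norm_num) (T := ⟨3, 1, 1, 2, 0, 0, 0, 5, 0, 0, 5⟩) rfl
    (by decide +kernel) (c := 5) (by decide +kernel) (w := 1) (by decide +kernel) hMJ hGZK W hW hK hH hP hnt (mod_cast hpD)
    hpN hqN hv hr hs hvs

/-- **`BSD(E,5)` for `424830gh1`** (`N = 424830 = 2·3·5·7²·17²`; SPLIT MULTIPLICATIVE at `5` (Kodaira `I5`, `c_5 = 5`); `#tors = 1`, `∏c = 580`,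
`r_an = 1`, `#Ш_an = 1`, `ρ̄_{E,5}` onto (Cremona galrep: no code); lane residue cell `(5, X11b)` (bsdN v4u/v5u of record: `residue:X11b`);
ALSO the unit's GEN 10 beyond-window DATA record in `X11b/BeyondWindowRecords57.lean` (binders as displayed there)). Tamagawa-OBSTRUCTED, shape J1: the ONLY prime `q ∣ N` with `5 ∣ c_q` is `q = p = 5` itself (Kodaira `I5` split, `c_5 = 5`, `w = ord_5 c_5 = 1`) — engines A (Tate `tateY`) = B (PARI
`elllocalred`, j269294) = C (observatory `TamLocal` ⟨5, 2, 1, 1, 0, 0, 0, 5, 0, 0, 5⟩, re-checked by the kernel below). Lane fields of record (`|D| ≤ 1511`): `-671`: `m = 5800` (`ord = 2`).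
DEEP FIELD `D = -1511` (prime): **`m = [E(K):ℤy_K] = 1160`, `ord_5 m = 1 = w`** (`ρ = 336400`; `L'(E,1) = 12.87779899`, `L(E^D,1) = 0.3934011553`, `ĥ(x) = 1.406159389`; `N_{E^D} = 969938294430`)
— engine 1 (j268106) = engine 2 (j269294): `m = 1160` EQUAL, dev. ≤ 3.3e-13, checks true; twist `E^D` (j269294): `N_F = 969938294430`, `#tors·∏c·#Ш_an = 1·1160·1` — `ord_5 #Ш_an(E^D) = 0`, `ord_5 ∏c(E^D) = 1` — BSD-consistent. Jetchev MAX-form: `ord_5 #Ш(E/ℚ) ≤ 2(w − w) = 0 = ord_5 #Ш_an` ⇒ Miller's `BSD(E,5)` modulo the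
displayed binders (`hMJ` FLAGGED `Miller11-Thm54-Cha-case`, `JET@p|N`; `hGZK`; Heegner datum; `hv`; `hr`; `hs`). Kernel: `Δ ≠ 0`,
global minimality (bounded Kraus criterion), `5 ∣ Δ ∧ 5 ∤ c₄`, `E[5]` irreducible (`ℓ = 13`, `#Ẽ(𝔽_13) = 19`, `a_13 = -5`, `X² − a_ℓX + ℓ` root-free
mod `5`), `c_5(W/ℚ_5) = 5` (`TamLocal` ⟨5, 2, 1, 1, 0, 0, 0, 5, 0, 0, 5⟩). Per pair; LITERAL currency; nothing booked.
[cite: Miller2011LMS, Thm. 5.4 (arXiv:1010.2431 p. 11) and Def. 1.1] [cite: Jetchev2008, Thm. 1.1] [cite: Mazur1978, §6 Prop. 6.3 (1) (p. 153)]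
[cite: Silverman1994, IV.9.4] [cite: Cremona2006, Table 1 (label 424830gh1)] -/
theorem bsdp_j424830gh1_5 (hMJ : thm54_cha_padicValNat_shaOrder_add_tamagawa_le)
    (hGZK : rank_eq_analyticRank_of_analyticRank_le_one) (W : WeierstrassCurve ℚ)
    (hW : W = ⟨1, 1, 1, 3748770430, 69610230833807⟩) {N : ℕ} [NeZero N] {K : Type} [Field K] [NumberField K]
    (hK : IsImaginaryQuadratic K) (hH : SatisfiesHeegnerHypothesis N K) {P : (W.baseChange K).toAffine.Point}
    (hP : IsHeegnerPoint N W K P) (hnt : ¬ IsOfFinAddOrder P) (hpD : ¬ (5 : ℤ) ∣ NumberField.discr K)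
    (hpN : ¬ 5 ^ 2 ∣ N) (hqN : 5 ∣ N) (hv : padicValNat 5 (AddSubgroup.zmultiples P).index ≤ 1)
    (hr : W.analyticRank ≤ 1) {s : ℚ} (hs : shaAn W = (s : ℂ)) (hvs : padicValRat 5 s = 0) : BSDp W 5 :=
  bsdp_prime_of_jetchevIndex_of_tamLocal 5 (by norm_num) (by norm_num) 1 1 1 3748770430 69610230833807 (by decide +kernel)
    (by decide +kernel) (by decide +kernel) (by decide +kernel) (by decide +kernel) 13 (by norm_num) (by norm_num) (by norm_num)
    (by decide +kernel) (n := 19) (by decide +kernel) (by decide +kernel) 5 (by norm_num) (T := ⟨5, 2, 1, 1, 0, 0, 0, 5, 0, 0, 5⟩) rfl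
    (by decide +kernel) (c := 5) (by decide +kernel) (w := 1) (by decide +kernel) hMJ hGZK W hW hK hH hP hnt (mod_cast hpD)
    hpN hqN hv hr hs hvs

/-- **`BSD(E,5)` for `426360bm1`** (`N = 426360 = 2³·3·5·11·17·19`; NON-SPLIT MULTIPLICATIVE at `5` (Kodaira `I2`, `c_5 = 2`); `#tors = 2`, `∏c = 40`,
`r_an = 1`, `#Ш_an = 1`, `ρ̄_{E,5}` onto (Cremona galrep: 2B); lane residue cell `(5, X11b)` (bsdN v4u/v5u of record: `residue:X11b`);
ALSO the unit's GEN 10 beyond-window DATA record in `X11b/BeyondWindowRecords57.lean` (binders as displayed there)). Tamagawa-OBSTRUCTED, shape J1: the ONLY prime `q ∣ N` with `5 ∣ c_q` is `q = 3` (Kodaira `I5` split, `c_3 = 5`, `w = ord_5 c_3 = 1`) — engines A (Tate `tateY`) = B (PARI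
`elllocalred`, j269294) = C (observatory `TamLocal` ⟨3, 1, 1, 2, 0, 0, 0, 5, 0, 0, 5⟩, re-checked by the kernel below). Lane fields of record (`|D| ≤ 1511`): `-791`: `m = 200` (`ord = 2`).
DEEP FIELD `D = -2279` (43·53): **`m = [E(K):ℤy_K] = 80`, `ord_5 m = 1 = w`** (`ρ = 1600`; `L'(E,1) = 12.19131771`, `L(E^D,1) = 1.259908791`, `ĥ(x) = 1.281883947`; `N_{E^D} = 2214446048760`)
— engine 1 (j268106) = engine 2 (j269294): `m = 80` EQUAL, dev. ≤ 1.0e-13, checks true; twist `E^D` (j269294): `N_F = 2214446048760`, `#tors·∏c·#Ш_an = 2·640·1` — `ord_5 #Ш_an(E^D) = 0`, `ord_5 ∏c(E^D) = 1` — BSD-consistent. Jetchev MAX-form: `ord_5 #Ш(E/ℚ) ≤ 2(w − w) = 0 = ord_5 #Ш_an` ⇒ Miller's `BSD(E,5)` modulo the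
displayed binders (`hMJ` FLAGGED `Miller11-Thm54-Cha-case`, `JET@p|N`; `hGZK`; Heegner datum; `hv`; `hr`; `hs`). Kernel: `Δ ≠ 0`,
global minimality (bounded Kraus criterion), `5 ∣ Δ ∧ 5 ∤ c₄`, `E[5]` irreducible (`ℓ = 7`, `#Ẽ(𝔽_7) = 4`, `a_7 = 4`, `X² − a_ℓX + ℓ` root-free
mod `5`), `c_3(W/ℚ_3) = 5` (`TamLocal` ⟨3, 1, 1, 2, 0, 0, 0, 5, 0, 0, 5⟩). Per pair; LITERAL currency; nothing booked.
[cite: Miller2011LMS, Thm. 5.4 (arXiv:1010.2431 p. 11) and Def. 1.1] [cite: Jetchev2008, Thm. 1.1] [cite: Mazur1978, §6 Prop. 6.3 (1) (p. 153)]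
[cite: Silverman1994, IV.9.4] [cite: Cremona2006, Table 1 (label 426360bm1)] -/
theorem bsdp_j426360bm1_5 (hMJ : thm54_cha_padicValNat_shaOrder_add_tamagawa_le)
    (hGZK : rank_eq_analyticRank_of_analyticRank_le_one) (W : WeierstrassCurve ℚ)
    (hW : W = ⟨0, 1, 0, -26016, 1606320⟩) {N : ℕ} [NeZero N] {K : Type} [Field K] [NumberField K]
    (hK : IsImaginaryQuadratic K) (hH : SatisfiesHeegnerHypothesis N K) {P : (W.baseChange K).toAffine.Point}
    (hP : IsHeegnerPoint N W K P) (hnt : ¬ IsOfFinAddOrder P) (hpD : ¬ (5 : ℤ) ∣ NumberField.discr K)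
    (hpN : ¬ 5 ^ 2 ∣ N) (hqN : 3 ∣ N) (hv : padicValNat 5 (AddSubgroup.zmultiples P).index ≤ 1)
    (hr : W.analyticRank ≤ 1) {s : ℚ} (hs : shaAn W = (s : ℂ)) (hvs : padicValRat 5 s = 0) : BSDp W 5 :=
  bsdp_prime_of_jetchevIndex_of_tamLocal 5 (by norm_num) (by norm_num) 0 1 0 (-26016) 1606320 (by decide +kernel)
    (by decide +kernel) (by decide +kernel) (by decide +kernel) (by decide +kernel) 7 (by norm_num) (by norm_num) (by norm_num)
    (by decide +kernel) (n := 4) (by decide +kernel) (by decide +kernel) 3 (by norm_num) (T := ⟨3, 1, 1, 2, 0, 0, 0, 5, 0, 0, 5⟩) rfl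
    (by decide +kernel) (c := 5) (by decide +kernel) (w := 1) (by decide +kernel) hMJ hGZK W hW hK hH hP hnt (mod_cast hpD)
    hpN hqN hv hr hs hvs

/-- **`BSD(E,5)` for `442890cf1`** (`N = 442890 = 2·3²·5·7·19·37`; NON-SPLIT MULTIPLICATIVE at `5` (Kodaira `I10`, `c_5 = 2`); `#tors = 2`, `∏c = 240`,
`r_an = 1`, `#Ш_an = 1`, `ρ̄_{E,5}` onto (Cremona galrep: 2B); lane residue cell `(5, X11b)` (bsdN v4u/v5u of record: `residue:X11b`);
ALSO the unit's GEN 10 beyond-window DATA record in `X11b/BeyondWindowRecords60.lean` (binders as displayed there)). Tamagawa-OBSTRUCTED, shape J1: the ONLY prime `q ∣ N` with `5 ∣ c_q` is `q = 19` (Kodaira `I5` split, `c_19 = 5`, `w = ord_5 c_19 = 1`) — engines A (Tate `tateY`) = B (PARI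
`elllocalred`, j269294) = C (observatory `TamLocal` ⟨19, 4, 1, 5, 0, 0, 0, 5, 0, 0, 5⟩, re-checked by the kernel below). Lane fields of record (`|D| ≤ 1511`): `-839`: `m = 1200` (`ord = 2`).
DEEP FIELD `D = -1991` (11·181): **`m = [E(K):ℤy_K] = 480`, `ord_5 m = 1 = w`** (`ρ = 57600`; `L'(E,1) = 5.019025413`, `L(E^D,1) = 1.796514157`, `ĥ(x) = 1.809886463`; `N_{E^D} = 1755651834090`)
— engine 1 (j268106) = engine 2 (j269294): `m = 480` EQUAL, dev. ≤ 8.5e-14, checks true; twist `E^D` (j269294): `N_F = 1755651834090`, `#tors·∏c·#Ш_an = 2·3840·1` — `ord_5 #Ш_an(E^D) = 0`, `ord_5 ∏c(E^D) = 1` — BSD-consistent. Jetchev MAX-form: `ord_5 #Ш(E/ℚ) ≤ 2(w − w) = 0 = ord_5 #Ш_an` ⇒ Miller's `BSD(E,5)` modulo the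
displayed binders (`hMJ` FLAGGED `Miller11-Thm54-Cha-case`, `JET@p|N`; `hGZK`; Heegner datum; `hv`; `hr`; `hs`). Kernel: `Δ ≠ 0`,
global minimality (bounded Kraus criterion), `5 ∣ Δ ∧ 5 ∤ c₄`, `E[5]` irreducible (`ℓ = 11`, `#Ẽ(𝔽_11) = 16`, `a_11 = -4`, `X² − a_ℓX + ℓ` root-free
mod `5`), `c_19(W/ℚ_19) = 5` (`TamLocal` ⟨19, 4, 1, 5, 0, 0, 0, 5, 0, 0, 5⟩). Per pair; LITERAL currency; nothing booked.
[cite: Miller2011LMS, Thm. 5.4 (arXiv:1010.2431 p. 11) and Def. 1.1] [cite: Jetchev2008, Thm. 1.1] [cite: Mazur1978, §6 Prop. 6.3 (1) (p. 153)]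
[cite: Silverman1994, IV.9.4] [cite: Cremona2006, Table 1 (label 442890cf1)] -/
theorem bsdp_j442890cf1_5 (hMJ : thm54_cha_padicValNat_shaOrder_add_tamagawa_le)
    (hGZK : rank_eq_analyticRank_of_analyticRank_le_one) (W : WeierstrassCurve ℚ)
    (hW : W = ⟨1, -1, 1, -114170558, -464769132019⟩) {N : ℕ} [NeZero N] {K : Type} [Field K] [NumberField K]
    (hK : IsImaginaryQuadratic K) (hH : SatisfiesHeegnerHypothesis N K) {P : (W.baseChange K).toAffine.Point}
    (hP : IsHeegnerPoint N W K P) (hnt : ¬ IsOfFinAddOrder P) (hpD : ¬ (5 : ℤ) ∣ NumberField.discr K)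
    (hpN : ¬ 5 ^ 2 ∣ N) (hqN : 19 ∣ N) (hv : padicValNat 5 (AddSubgroup.zmultiples P).index ≤ 1)
    (hr : W.analyticRank ≤ 1) {s : ℚ} (hs : shaAn W = (s : ℂ)) (hvs : padicValRat 5 s = 0) : BSDp W 5 :=
  bsdp_prime_of_jetchevIndex_of_tamLocal 5 (by norm_num) (by norm_num) 1 (-1) 1 (-114170558) (-464769132019) (by decide +kernel)
    (by decide +kernel) (by decide +kernel) (by decide +kernel) (by decide +kernel) 11 (by norm_num) (by norm_num) (by norm_num)
    (by decide +kernel) (n := 16) (by decide +kernel) (by decide +kernel) 19 (by norm_num) (T := ⟨19, 4, 1, 5, 0, 0, 0, 5, 0, 0, 5⟩) rfl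
    (by decide +kernel) (c := 5) (by decide +kernel) (w := 1) (by decide +kernel) hMJ hGZK W hW hK hH hP hnt (mod_cast hpD)
    hpN hqN hv hr hs hvs

/-- **`BSD(E,5)` for `446880de1`** (`N = 446880 = 2⁵·3·5·7²·19`; NON-SPLIT MULTIPLICATIVE at `5` (Kodaira `I3`, `c_5 = 1`); `#tors = 1`, `∏c = 10`,
`r_an = 1`, `#Ш_an = 1`, `ρ̄_{E,5}` onto (Cremona galrep: no code); lane residue cell `(5, X11b)` (bsdN v4u/v5u of record: `residue:X11b`);
ALSO the unit's GEN 10 beyond-window DATA record in `X11b/BeyondWindowRecords60.lean` (binders as displayed there)). Tamagawa-OBSTRUCTED, shape J1: the ONLY prime `q ∣ N` with `5 ∣ c_q` is `q = 3` (Kodaira `I5` split, `c_3 = 5`, `w = ord_5 c_3 = 1`) — engines A (Tate `tateY`) = B (PARI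
`elllocalred`, j269294) = C (observatory `TamLocal` ⟨3, 1, 1, 2, 0, 0, 0, 5, 0, 0, 5⟩, re-checked by the kernel below). Lane fields of record (`|D| ≤ 1511`): `-839`: `m = 200` (`ord = 2`).
DEEP FIELD `D = -1319` (prime): **`m = [E(K):ℤy_K] = 60`, `ord_5 m = 1 = w`** (`ρ = 900`; `L'(E,1) = 4.903829962`, `L(E^D,1) = 1.041733064`, `ĥ(x) = 9.06371911`; `N_{E^D} = 777464395680`)
— engine 1 (j268106) = engine 2 (j269294): `m = 60` EQUAL, dev. ≤ 4.6e-14, checks true; twist `E^D` (j269294): `N_F = 777464395680`, `#tors·∏c·#Ш_an = 1·20·9` — `ord_5 #Ш_an(E^D) = 0`, `ord_5 ∏c(E^D) = 1` — BSD-consistent. Jetchev MAX-form: `ord_5 #Ш(E/ℚ) ≤ 2(w − w) = 0 = ord_5 #Ш_an` ⇒ Miller's `BSD(E,5)` modulo the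
displayed binders (`hMJ` FLAGGED `Miller11-Thm54-Cha-case`, `JET@p|N`; `hGZK`; Heegner datum; `hv`; `hr`; `hs`). Kernel: `Δ ≠ 0`,
global minimality (bounded Kraus criterion), `5 ∣ Δ ∧ 5 ∤ c₄`, `E[5]` irreducible (`ℓ = 29`, `#Ẽ(𝔽_29) = 38`, `a_29 = -8`, `X² − a_ℓX + ℓ` root-free
mod `5`), `c_3(W/ℚ_3) = 5` (`TamLocal` ⟨3, 1, 1, 2, 0, 0, 0, 5, 0, 0, 5⟩). Per pair; LITERAL currency; nothing booked.
[cite: Miller2011LMS, Thm. 5.4 (arXiv:1010.2431 p. 11) and Def. 1.1] [cite: Jetchev2008, Thm. 1.1] [cite: Mazur1978, §6 Prop. 6.3 (1) (p. 153)]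
[cite: Silverman1994, IV.9.4] [cite: Cremona2006, Table 1 (label 446880de1)] -/
theorem bsdp_j446880de1_5 (hMJ : thm54_cha_padicValNat_shaOrder_add_tamagawa_le)
    (hGZK : rank_eq_analyticRank_of_analyticRank_le_one) (W : WeierstrassCurve ℚ)
    (hW : W = ⟨0, 1, 0, -3784776, -2847596760⟩) {N : ℕ} [NeZero N] {K : Type} [Field K] [NumberField K]
    (hK : IsImaginaryQuadratic K) (hH : SatisfiesHeegnerHypothesis N K) {P : (W.baseChange K).toAffine.Point}
    (hP : IsHeegnerPoint N W K P) (hnt : ¬ IsOfFinAddOrder P) (hpD : ¬ (5 : ℤ) ∣ NumberField.discr K)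
    (hpN : ¬ 5 ^ 2 ∣ N) (hqN : 3 ∣ N) (hv : padicValNat 5 (AddSubgroup.zmultiples P).index ≤ 1)
    (hr : W.analyticRank ≤ 1) {s : ℚ} (hs : shaAn W = (s : ℂ)) (hvs : padicValRat 5 s = 0) : BSDp W 5 :=
  bsdp_prime_of_jetchevIndex_of_tamLocal 5 (by norm_num) (by norm_num) 0 1 0 (-3784776) (-2847596760) (by decide +kernel)
    (by decide +kernel) (by decide +kernel) (by decide +kernel) (by decide +kernel) 29 (by norm_num) (by norm_num) (by norm_num)
    (by decide +kernel) (n := 38) (by decide +kernel) (by decide +kernel) 3 (by norm_num) (T := ⟨3, 1, 1, 2, 0, 0, 0, 5, 0, 0, 5⟩) rfl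
    (by decide +kernel) (c := 5) (by decide +kernel) (w := 1) (by decide +kernel) hMJ hGZK W hW hK hH hP hnt (mod_cast hpD)
    hpN hqN hv hr hs hvs

/-- **`BSD(E,5)` for `451560j1`** (`N = 451560 = 2³·3·5·53·71`; SPLIT MULTIPLICATIVE at `5` (Kodaira `I2`, `c_5 = 2`); `#tors = 1`, `∏c = 20`,
`r_an = 1`, `#Ш_an = 1`, `ρ̄_{E,5}` onto (Cremona galrep: no code); lane residue cell `(5, X11b)` (bsdN v4u/v5u of record: `residue:X11b`);
ALSO the unit's GEN 10 beyond-window DATA record in `X11b/BeyondWindowRecords61.lean` (binders as displayed there)). Tamagawa-OBSTRUCTED, shape J1: the ONLY prime `q ∣ N` with `5 ∣ c_q` is `q = 71` (Kodaira `I5` split, `c_71 = 5`, `w = ord_5 c_71 = 1`) — engines A (Tate `tateY`) = B (PARI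
`elllocalred`, j269294) = C (observatory `TamLocal` ⟨71, 8, 1, 1, 0, 0, 0, 5, 0, 0, 5⟩, re-checked by the kernel below). Lane fields of record (`|D| ≤ 1511`): `-911`: `m = 200` (`ord = 2`).
DEEP FIELD `D = -1319` (prime): **`m = [E(K):ℤy_K] = 40`, `ord_5 m = 1 = w`** (`ρ = 400`; `L'(E,1) = 8.195279268`, `L(E^D,1) = 0.1628587583`, `ĥ(x) = 1.459621215`; `N_{E^D} = 785606477160`)
— engine 1 (j268106) = engine 2 (j269294): `m = 40` EQUAL, dev. ≤ 1.2e-13, checks true; twist `E^D` (j269294): `N_F = 785606477160`, `#tors·∏c·#Ш_an = 1·20·1` — `ord_5 #Ш_an(E^D) = 0`, `ord_5 ∏c(E^D) = 1` — BSD-consistent. Jetchev MAX-form: `ord_5 #Ш(E/ℚ) ≤ 2(w − w) = 0 = ord_5 #Ш_an` ⇒ Miller's `BSD(E,5)` modulo the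
displayed binders (`hMJ` FLAGGED `Miller11-Thm54-Cha-case`, `JET@p|N`; `hGZK`; Heegner datum; `hv`; `hr`; `hs`). Kernel: `Δ ≠ 0`,
global minimality (bounded Kraus criterion), `5 ∣ Δ ∧ 5 ∤ c₄`, `E[5]` irreducible (`ℓ = 13`, `#Ẽ(𝔽_13) = 14`, `a_13 = 0`, `X² − a_ℓX + ℓ` root-free
mod `5`), `c_71(W/ℚ_71) = 5` (`TamLocal` ⟨71, 8, 1, 1, 0, 0, 0, 5, 0, 0, 5⟩). Per pair; LITERAL currency; nothing booked.
[cite: Miller2011LMS, Thm. 5.4 (arXiv:1010.2431 p. 11) and Def. 1.1] [cite: Jetchev2008, Thm. 1.1] [cite: Mazur1978, §6 Prop. 6.3 (1) (p. 153)]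
[cite: Silverman1994, IV.9.4] [cite: Cremona2006, Table 1 (label 451560j1)] -/
theorem bsdp_j451560j1_5 (hMJ : thm54_cha_padicValNat_shaOrder_add_tamagawa_le)
    (hGZK : rank_eq_analyticRank_of_analyticRank_le_one) (W : WeierstrassCurve ℚ)
    (hW : W = ⟨0, -1, 0, -110760, -2731383⟩) {N : ℕ} [NeZero N] {K : Type} [Field K] [NumberField K]
    (hK : IsImaginaryQuadratic K) (hH : SatisfiesHeegnerHypothesis N K) {P : (W.baseChange K).toAffine.Point}
    (hP : IsHeegnerPoint N W K P) (hnt : ¬ IsOfFinAddOrder P) (hpD : ¬ (5 : ℤ) ∣ NumberField.discr K)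
    (hpN : ¬ 5 ^ 2 ∣ N) (hqN : 71 ∣ N) (hv : padicValNat 5 (AddSubgroup.zmultiples P).index ≤ 1)
    (hr : W.analyticRank ≤ 1) {s : ℚ} (hs : shaAn W = (s : ℂ)) (hvs : padicValRat 5 s = 0) : BSDp W 5 :=
  bsdp_prime_of_jetchevIndex_of_tamLocal 5 (by norm_num) (by norm_num) 0 (-1) 0 (-110760) (-2731383) (by decide +kernel)
    (by decide +kernel) (by decide +kernel) (by decide +kernel) (by decide +kernel) 13 (by norm_num) (by norm_num) (by norm_num)
    (by decide +kernel) (n := 14) (by decide +kernel) (by decide +kernel) 71 (by norm_num) (T := ⟨71, 8, 1, 1, 0, 0, 0, 5, 0, 0, 5⟩) rfl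
    (by decide +kernel) (c := 5) (by decide +kernel) (w := 1) (by decide +kernel) hMJ hGZK W hW hK hH hP hnt (mod_cast hpD)
    hpN hqN hv hr hs hvs

/-- **`BSD(E,5)` for `454155c1`** (`N = 454155 = 3·5·13·17·137`; SPLIT MULTIPLICATIVE at `5` (Kodaira `I16`, `c_5 = 16`); `#tors = 1`, `∏c = 320`,
`r_an = 1`, `#Ш_an = 1`, `ρ̄_{E,5}` onto (Cremona galrep: no code); lane residue cell `(5, X11b)` (bsdN v4u/v5u of record: `residue:X11b`);
ALSO the unit's GEN 10 beyond-window DATA record in `X11b/BeyondWindowRecords61.lean` (binders as displayed there)). Tamagawa-OBSTRUCTED, shape J1: the ONLY prime `q ∣ N` with `5 ∣ c_q` is `q = 137` (Kodaira `I5` split, `c_137 = 5`, `w = ord_5 c_137 = 1`) — engines A (Tate `tateY`) = B (PARI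
`elllocalred`, j269294) = C (observatory `TamLocal` ⟨137, 11, 1, 108, 0, 0, 0, 5, 0, 0, 5⟩, re-checked by the kernel below). Lane fields of record (`|D| ≤ 1511`): `-404`: `m = 3200` (`ord = 2`).
DEEP FIELD `D = -1199` (11·109): **`m = [E(K):ℤy_K] = 1280`, `ord_5 m = 1 = w`** (`ρ = 409600`; `L'(E,1) = 6.145255883`, `L(E^D,1) = 0.523408571`, `ĥ(x) = 0.5444875293`; `N_{E^D} = 652893682155`)
— engine 1 (j268106) = engine 2 (j269294): `m = 1280` EQUAL, dev. ≤ 2.0e-14, checks true; twist `E^D` (j269294): `N_F = 652893682155`, `#tors·∏c·#Ш_an = 1·1280·1` — `ord_5 #Ш_an(E^D) = 0`, `ord_5 ∏c(E^D) = 1` — BSD-consistent. Jetchev MAX-form: `ord_5 #Ш(E/ℚ) ≤ 2(w − w) = 0 = ord_5 #Ш_an` ⇒ Miller's `BSD(E,5)` modulo the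
displayed binders (`hMJ` FLAGGED `Miller11-Thm54-Cha-case`, `JET@p|N`; `hGZK`; Heegner datum; `hv`; `hr`; `hs`). Kernel: `Δ ≠ 0`,
global minimality (bounded Kraus criterion), `5 ∣ Δ ∧ 5 ∤ c₄`, `E[5]` irreducible (`ℓ = 7`, `#Ẽ(𝔽_7) = 7`, `a_7 = 1`, `X² − a_ℓX + ℓ` root-free
mod `5`), `c_137(W/ℚ_137) = 5` (`TamLocal` ⟨137, 11, 1, 108, 0, 0, 0, 5, 0, 0, 5⟩). Per pair; LITERAL currency; nothing booked.
[cite: Miller2011LMS, Thm. 5.4 (arXiv:1010.2431 p. 11) and Def. 1.1] [cite: Jetchev2008, Thm. 1.1] [cite: Mazur1978, §6 Prop. 6.3 (1) (p. 153)]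
[cite: Silverman1994, IV.9.4] [cite: Cremona2006, Table 1 (label 454155c1)] -/
theorem bsdp_j454155c1_5 (hMJ : thm54_cha_padicValNat_shaOrder_add_tamagawa_le)
    (hGZK : rank_eq_analyticRank_of_analyticRank_le_one) (W : WeierstrassCurve ℚ)
    (hW : W = ⟨0, 1, 1, -12925669270, 565541525593006⟩) {N : ℕ} [NeZero N] {K : Type} [Field K] [NumberField K]
    (hK : IsImaginaryQuadratic K) (hH : SatisfiesHeegnerHypothesis N K) {P : (W.baseChange K).toAffine.Point}
    (hP : IsHeegnerPoint N W K P) (hnt : ¬ IsOfFinAddOrder P) (hpD : ¬ (5 : ℤ) ∣ NumberField.discr K)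
    (hpN : ¬ 5 ^ 2 ∣ N) (hqN : 137 ∣ N) (hv : padicValNat 5 (AddSubgroup.zmultiples P).index ≤ 1)
    (hr : W.analyticRank ≤ 1) {s : ℚ} (hs : shaAn W = (s : ℂ)) (hvs : padicValRat 5 s = 0) : BSDp W 5 :=
  bsdp_prime_of_jetchevIndex_of_tamLocal 5 (by norm_num) (by norm_num) 0 1 1 (-12925669270) 565541525593006 (by decide +kernel)
    (by decide +kernel) (by decide +kernel) (by decide +kernel) (by decide +kernel) 7 (by norm_num) (by norm_num) (by norm_num)
    (by decide +kernel) (n := 7) (by decide +kernel) (by decide +kernel) 137 (by norm_num) (T := ⟨137, 11, 1, 108, 0, 0, 0, 5, 0, 0, 5⟩) rfl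
    (by decide +kernel) (c := 5) (by decide +kernel) (w := 1) (by decide +kernel) hMJ hGZK W hW hK hH hP hnt (mod_cast hpD)
    hpN hqN hv hr hs hvs

/-- **`BSD(E,5)` for `457710k1`** (`N = 457710 = 2·3·5·11·19·73`; NON-SPLIT MULTIPLICATIVE at `5` (Kodaira `I7`, `c_5 = 1`); `#tors = 1`, `∏c = 5`,
`r_an = 1`, `#Ш_an = 1`, `ρ̄_{E,5}` onto (Cremona galrep: no code); lane residue cell `(5, X11b)` (bsdN v4u/v5u of record: `residue:X11b`);
ALSO the unit's GEN 10 beyond-window DATA record in `X11b/BeyondWindowRecords62.lean` (binders as displayed there)). Tamagawa-OBSTRUCTED, shape J1: the ONLY prime `q ∣ N` with `5 ∣ c_q` is `q = 19` (Kodaira `I5` split, `c_19 = 5`, `w = ord_5 c_19 = 1`) — engines A (Tate `tateY`) = B (PARI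
`elllocalred`, j269294) = C (observatory `TamLocal` ⟨19, 4, 1, 11, 0, 0, 0, 5, 0, 0, 5⟩, re-checked by the kernel below). Lane fields of record (`|D| ≤ 1511`): `-791`: `m = 100` (`ord = 2`).
DEEP FIELD `D = -1751` (17·103): **`m = [E(K):ℤy_K] = 10`, `ord_5 m = 1 = w`** (`ρ = 25`; `L'(E,1) = 6.259581277`, `L(E^D,1) = 0.01997327145`, `ĥ(x) = 10.12305686`; `N_{E^D} = 1403339317710`)
— engine 1 (j268106) = engine 2 (j269294): `m = 10` EQUAL, dev. ≤ 3.5e-14, checks true; twist `E^D` (j269294): `N_F = 1403339317710`, `#tors·∏c·#Ш_an = 1·10·1` — `ord_5 #Ш_an(E^D) = 0`, `ord_5 ∏c(E^D) = 1` — BSD-consistent. Jetchev MAX-form: `ord_5 #Ш(E/ℚ) ≤ 2(w − w) = 0 = ord_5 #Ш_an` ⇒ Miller's `BSD(E,5)` modulo the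
displayed binders (`hMJ` FLAGGED `Miller11-Thm54-Cha-case`, `JET@p|N`; `hGZK`; Heegner datum; `hv`; `hr`; `hs`). Kernel: `Δ ≠ 0`,
global minimality (bounded Kraus criterion), `5 ∣ Δ ∧ 5 ∤ c₄`, `E[5]` irreducible (`ℓ = 7`, `#Ẽ(𝔽_7) = 4`, `a_7 = 4`, `X² − a_ℓX + ℓ` root-free
mod `5`), `c_19(W/ℚ_19) = 5` (`TamLocal` ⟨19, 4, 1, 11, 0, 0, 0, 5, 0, 0, 5⟩). Per pair; LITERAL currency; nothing booked.
[cite: Miller2011LMS, Thm. 5.4 (arXiv:1010.2431 p. 11) and Def. 1.1] [cite: Jetchev2008, Thm. 1.1] [cite: Mazur1978, §6 Prop. 6.3 (1) (p. 153)]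
[cite: Silverman1994, IV.9.4] [cite: Cremona2006, Table 1 (label 457710k1)] -/
theorem bsdp_j457710k1_5 (hMJ : thm54_cha_padicValNat_shaOrder_add_tamagawa_le)
    (hGZK : rank_eq_analyticRank_of_analyticRank_le_one) (W : WeierstrassCurve ℚ)
    (hW : W = ⟨1, 1, 0, 735807, 920580597⟩) {N : ℕ} [NeZero N] {K : Type} [Field K] [NumberField K]
    (hK : IsImaginaryQuadratic K) (hH : SatisfiesHeegnerHypothesis N K) {P : (W.baseChange K).toAffine.Point}
    (hP : IsHeegnerPoint N W K P) (hnt : ¬ IsOfFinAddOrder P) (hpD : ¬ (5 : ℤ) ∣ NumberField.discr K)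
    (hpN : ¬ 5 ^ 2 ∣ N) (hqN : 19 ∣ N) (hv : padicValNat 5 (AddSubgroup.zmultiples P).index ≤ 1)
    (hr : W.analyticRank ≤ 1) {s : ℚ} (hs : shaAn W = (s : ℂ)) (hvs : padicValRat 5 s = 0) : BSDp W 5 :=
  bsdp_prime_of_jetchevIndex_of_tamLocal 5 (by norm_num) (by norm_num) 1 1 0 735807 920580597 (by decide +kernel)
    (by decide +kernel) (by decide +kernel) (by decide +kernel) (by decide +kernel) 7 (by norm_num) (by norm_num) (by norm_num)
    (by decide +kernel) (n := 4) (by decide +kernel) (by decide +kernel) 19 (by norm_num) (T := ⟨19, 4, 1, 11, 0, 0, 0, 5, 0, 0, 5⟩) rfl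
    (by decide +kernel) (c := 5) (by decide +kernel) (w := 1) (by decide +kernel) hMJ hGZK W hW hK hH hP hnt (mod_cast hpD)
    hpN hqN hv hr hs hvs

/-- **`BSD(E,5)` for `459690bo1`** (`N = 459690 = 2·3·5·7·11·199`; SPLIT MULTIPLICATIVE at `5` (Kodaira `I1`, `c_5 = 1`); `#tors = 1`, `∏c = 25`,
`r_an = 1`, `#Ш_an = 1`, `ρ̄_{E,5}` onto (Cremona galrep: no code); lane residue cell `(5, X11b)` (bsdN v4u/v5u of record: `residue:X11b`);
ALSO the unit's GEN 10 beyond-window DATA record in `X11b/BeyondWindowRecords63.lean` (binders as displayed there)). Tamagawa-OBSTRUCTED, shape J1: the ONLY prime `q ∣ N` with `5 ∣ c_q` is `q = 2` (Kodaira `I25` split, `c_2 = 25`, `w = ord_5 c_2 = 2`) — engines A (Tate `tateY`) = B (PARI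
`elllocalred`, j269294) = C (observatory `TamLocal` ⟨2, 1, 1, 0, 0, 0, 0, 25, 0, 0, 25⟩, re-checked by the kernel below). Lane fields of record (`|D| ≤ 1511`): `-1151`: `m = 250` (`ord = 3`).
DEEP FIELD `D = -1559` (prime): **`m = [E(K):ℤy_K] = 50`, `ord_5 m = 2 = w`** (`ρ = 625`; `L'(E,1) = 20.49446133`, `L(E^D,1) = 0.1732945952`, `ĥ(x) = 10.1599974`; `N_{E^D} = 1117267810890`)
— engine 1 (j268106) = engine 2 (j269294): `m = 50` EQUAL, dev. ≤ 5.1e-13, checks true; twist `E^D` (j269294): `N_F = 1117267810890`, `#tors·∏c·#Ш_an = 1·25·1` — `ord_5 #Ш_an(E^D) = 0`, `ord_5 ∏c(E^D) = 2` — BSD-consistent. Jetchev MAX-form: `ord_5 #Ш(E/ℚ) ≤ 2(w − w) = 0 = ord_5 #Ш_an` ⇒ Miller's `BSD(E,5)` modulo the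
displayed binders (`hMJ` FLAGGED `Miller11-Thm54-Cha-case`, `JET@p|N`; `hGZK`; Heegner datum; `hv`; `hr`; `hs`). Kernel: `Δ ≠ 0`,
global minimality (bounded Kraus criterion), `5 ∣ Δ ∧ 5 ∤ c₄`, `E[5]` irreducible (`ℓ = 13`, `#Ẽ(𝔽_13) = 9`, `a_13 = 5`, `X² − a_ℓX + ℓ` root-free
mod `5`), `c_2(W/ℚ_2) = 25` (`TamLocal` ⟨2, 1, 1, 0, 0, 0, 0, 25, 0, 0, 25⟩). Per pair; LITERAL currency; nothing booked.
[cite: Miller2011LMS, Thm. 5.4 (arXiv:1010.2431 p. 11) and Def. 1.1] [cite: Jetchev2008, Thm. 1.1] [cite: Mazur1978, §6 Prop. 6.3 (1) (p. 153)]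
[cite: Silverman1994, IV.9.4] [cite: Cremona2006, Table 1 (label 459690bo1)] -/
theorem bsdp_j459690bo1_5 (hMJ : thm54_cha_padicValNat_shaOrder_add_tamagawa_le)
    (hGZK : rank_eq_analyticRank_of_analyticRank_le_one) (W : WeierstrassCurve ℚ)
    (hW : W = ⟨1, 0, 0, -12257070, -16517897340⟩) {N : ℕ} [NeZero N] {K : Type} [Field K] [NumberField K]
    (hK : IsImaginaryQuadratic K) (hH : SatisfiesHeegnerHypothesis N K) {P : (W.baseChange K).toAffine.Point}
    (hP : IsHeegnerPoint N W K P) (hnt : ¬ IsOfFinAddOrder P) (hpD : ¬ (5 : ℤ) ∣ NumberField.discr K)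
    (hpN : ¬ 5 ^ 2 ∣ N) (hqN : 2 ∣ N) (hv : padicValNat 5 (AddSubgroup.zmultiples P).index ≤ 2)
    (hr : W.analyticRank ≤ 1) {s : ℚ} (hs : shaAn W = (s : ℂ)) (hvs : padicValRat 5 s = 0) : BSDp W 5 :=
  bsdp_prime_of_jetchevIndex_of_tamLocal 5 (by norm_num) (by norm_num) 1 0 0 (-12257070) (-16517897340) (by decide +kernel)
    (by decide +kernel) (by decide +kernel) (by decide +kernel) (by decide +kernel) 13 (by norm_num) (by norm_num) (by norm_num)
    (by decide +kernel) (n := 9) (by decide +kernel) (by decide +kernel) 2 (by norm_num) (T := ⟨2, 1, 1, 0, 0, 0, 0, 25, 0, 0, 25⟩) rfl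
    (by decide +kernel) (c := 25) (by decide +kernel) (w := 2) (by decide +kernel) hMJ hGZK W hW hK hH hP hnt (mod_cast hpD)
    hpN hqN hv hr hs hvs

/-- **`BSD(E,5)` for `459690bq1`** (`N = 459690 = 2·3·5·7·11·199`; SPLIT MULTIPLICATIVE at `5` (Kodaira `I1`, `c_5 = 1`); `#tors = 2`, `∏c = 240`,
`r_an = 1`, `#Ш_an = 1`, `ρ̄_{E,5}` onto (Cremona galrep: 2B); lane residue cell `(5, X11b)` (bsdN v4u/v5u of record: `residue:X11b`);
ALSO the unit's GEN 10 beyond-window DATA record in `X11b/BeyondWindowRecords63.lean` (binders as displayed there)). Tamagawa-OBSTRUCTED, shape J1: the ONLY prime `q ∣ N` with `5 ∣ c_q` is `q = 11` (Kodaira `I5` split, `c_11 = 5`, `w = ord_5 c_11 = 1`) — engines A (Tate `tateY`) = B (PARI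
`elllocalred`, j269294) = C (observatory `TamLocal` ⟨11, 3, 1, 0, 0, 0, 0, 5, 0, 0, 5⟩, re-checked by the kernel below). Lane fields of record (`|D| ≤ 1511`): `-1151`: `m = 1200` (`ord = 2`).
DEEP FIELD `D = -1559` (prime): **`m = [E(K):ℤy_K] = 240`, `ord_5 m = 1 = w`** (`ρ = 14400`; `L'(E,1) = 19.89167811`, `L(E^D,1) = 1.169534605`, `ĥ(x) = 2.910261577`; `N_{E^D} = 1117267810890`)
— engine 1 (j268106) = engine 2 (j269294): `m = 240` EQUAL, dev. ≤ 1.6e-13, checks true; twist `E^D` (j269294): `N_F = 1117267810890`, `#tors·∏c·#Ш_an = 2·960·1` — `ord_5 #Ш_an(E^D) = 0`, `ord_5 ∏c(E^D) = 1` — BSD-consistent. Jetchev MAX-form: `ord_5 #Ш(E/ℚ) ≤ 2(w − w) = 0 = ord_5 #Ш_an` ⇒ Miller's `BSD(E,5)` modulo the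
displayed binders (`hMJ` FLAGGED `Miller11-Thm54-Cha-case`, `JET@p|N`; `hGZK`; Heegner datum; `hv`; `hr`; `hs`). Kernel: `Δ ≠ 0`,
global minimality (bounded Kraus criterion), `5 ∣ Δ ∧ 5 ∤ c₄`, `E[5]` irreducible (`ℓ = 13`, `#Ẽ(𝔽_13) = 12`, `a_13 = 2`, `X² − a_ℓX + ℓ` root-free
mod `5`), `c_11(W/ℚ_11) = 5` (`TamLocal` ⟨11, 3, 1, 0, 0, 0, 0, 5, 0, 0, 5⟩). Per pair; LITERAL currency; nothing booked.
[cite: Miller2011LMS, Thm. 5.4 (arXiv:1010.2431 p. 11) and Def. 1.1] [cite: Jetchev2008, Thm. 1.1] [cite: Mazur1978, §6 Prop. 6.3 (1) (p. 153)]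
[cite: Silverman1994, IV.9.4] [cite: Cremona2006, Table 1 (label 459690bq1)] -/
theorem bsdp_j459690bq1_5 (hMJ : thm54_cha_padicValNat_shaOrder_add_tamagawa_le)
    (hGZK : rank_eq_analyticRank_of_analyticRank_le_one) (W : WeierstrassCurve ℚ)
    (hW : W = ⟨1, 0, 0, -3103155, -2059903395⟩) {N : ℕ} [NeZero N] {K : Type} [Field K] [NumberField K]
    (hK : IsImaginaryQuadratic K) (hH : SatisfiesHeegnerHypothesis N K) {P : (W.baseChange K).toAffine.Point}
    (hP : IsHeegnerPoint N W K P) (hnt : ¬ IsOfFinAddOrder P) (hpD : ¬ (5 : ℤ) ∣ NumberField.discr K)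
    (hpN : ¬ 5 ^ 2 ∣ N) (hqN : 11 ∣ N) (hv : padicValNat 5 (AddSubgroup.zmultiples P).index ≤ 1)
    (hr : W.analyticRank ≤ 1) {s : ℚ} (hs : shaAn W = (s : ℂ)) (hvs : padicValRat 5 s = 0) : BSDp W 5 :=
  bsdp_prime_of_jetchevIndex_of_tamLocal 5 (by norm_num) (by norm_num) 1 0 0 (-3103155) (-2059903395) (by decide +kernel)
    (by decide +kernel) (by decide +kernel) (by decide +kernel) (by decide +kernel) 13 (by norm_num) (by norm_num) (by norm_num)
    (by decide +kernel) (n := 12) (by decide +kernel) (by decide +kernel) 11 (by norm_num) (T := ⟨11, 3, 1, 0, 0, 0, 0, 5, 0, 0, 5⟩) rfl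
    (by decide +kernel) (c := 5) (by decide +kernel) (w := 1) (by decide +kernel) hMJ hGZK W hW hK hH hP hnt (mod_cast hpD)
    hpN hqN hv hr hs hvs

end Summit.BirchSwinnertonDyer.Rank1Residual.X11b

end
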